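import Summits.BirchSwinnertonDyer.BirchSwinnertonDyer.Theorems.ResidualThetaTransportAtTwoThetaLayerLambdaCongruenceAtTwoCuspSpanGenerationB1
import Mathlib.NumberTheory.LSeries.PrimesInAP
import HarnessLib

/-!
# Route `ResidualThetaTransportAtTwo`, cruxes Kan⁺ (stmt-BirchSwinnertonDyer-20688) / 21437: **4-INVARIANCE of the
# `B₁`-character at every PRIME level** (Dirichlet) and the `K/E` certificate calculus

Cell `bsd-wall`, lead prover `bsd-wall-rtt-p3` g9 (2026-08-28). THEOREMS ONLY (no `def`, no `sorry`);
`--supports stmt-BirchSwinnertonDyer-20688`. BSD is not proved by this; the node `CuspSpanEvenAtTwo N` stays a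
hypothesis at every level not covered by a certificate.

SETTING (as in `…CuspSpanGenerationB1`). `χ : Γ₀(N) → ZMod 2` additive, killing the elements of trace `0, ±1, ±2`
(`hsmall`) and the elements whose lower-right entry is `±4^k`, `k ≥ 1` (`hkill`). On the elements with upper-right entry
`−1` ("`B₁`") `χ` depends only on `d mod N` (`chi_eq_of_apply_zero_one_eq_neg_one`): write `F(u) = χ(β)`, `d(β) ≡ u`.

THEOREM 1 (`chi_eq_of_b_neg_one_of_mul_d_eq_neg_one`, any `N`). `F(u) = F(−1/u)`: `β♯ := (−d, −1; c, −a)` satisfies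
`β β♯ = −I` (trace `−2`).

THEOREM 2 (`chi_eq_of_b_neg_one_of_mul_d_eq_neg_four`, `N = p` an odd prime). `F(u) = F(−4/u)`, hence
(`chi_eq_of_b_neg_one_of_d_eq_four_mul`) **`F(4u) = F(u)` for every unit `u`**. PROOF. By DIRICHLET's theorem
(Mathlib `Nat.forall_exists_prime_gt_and_modEq`) pick a prime `q ≡ −1 (mod 4(p−1))`, `q ≡ u (mod p)`. Then
`e := (q−1)/2 ≡ −1 (mod 2(p−1))`, so `k := e² ≡ 1 (mod p−1)` and `4^k ≡ 4 (mod p)` (Fermat), while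
`4^e = 2^{q−1} ≡ 1 (mod q)` (Fermat) gives `q ∣ 4^k − 1 = q m₀`. With `α₁ q + κ₁ p = 1`, `β₁ := (α₁, −1; pκ₁, q)` and
`β₂ := (α₂, −1; pκ₂, δ₂)`, `δ₂ := −m₀ − α₁`, the product `β₁β₂` has lower-right entry `−pκ₁ + qδ₂ = −4^k`, so
`χ(β₁) = χ(β₂)`, and `q δ₂ ≡ −4^k ≡ −4 (mod p)`. No hypothesis on `p` beyond `p` prime, `p ≠ 2`.

`K/E` CALCULUS (§3): the residue facts `K(r)` («`χ` kills every `b = −1` element with `d ≡ r`») and `E(r, s)`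
(«`χ` agrees on the `b = −1` elements with `d ≡ r` and `d ≡ s`»), transport of `K` along `E`, `E` from Theorems 1–2,
and the three-term rules of `…CuspSpanGenerationB1` in `K/E` form (`KE_rule_pos/neg`: in `χ(β₁) + χ(β₂) + χ(β₃) = 0`
an `E` between two of the three gives `K` of the third, a `K` of one gives `E` of the other two). With these, a
certificate for (G″)_p needs ONE seed per orbit of `u ↦ 4u, u ↦ −1/u` — this seat's `prop2.py` finds such a
certificate for EVERY odd prime `p < 12000` (zero-propagation for `[(ℤ/p)ˣ : ⟨4, −1, elliptic⟩]` odd, one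
quadratic class otherwise); the files `…CuspSpanCertP*.lean` land the primes `p ≤ 300`.

References: P. G. L. Dirichlet (1837) / Mathlib `PrimesInAP`; H. Rademacher, Abh. Math. Sem. Hamburg 7 (1929) §1
[Rademacher1929]; A. W. Knapp, *Elliptic curves* (1992) Prop. 11.1 [Knapp1993]; R. Pollack, Duke Math. J. 118 (2003)
Conj. 6.3 [Pollack2003].
-/

set_option autoImplicit false
set_option linter.dupNamespace false

open scoped MatrixGroups

open CongruenceSubgroup

namespace Summit.BirchSwinnertonDyer.BirchSwinnertonDyer.Theorems.SignedMuAtTwo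

/-! ## §1. The `S`-companion: `F(u) = F(−1/u)` (any level) -/

section AnyLevel

variable {N : ℕ} {χ : Gamma0 N → ZMod 2}

/-- A `b = −1` element of `Γ₀(N)` with prescribed unit residue `d ≡ r (mod N)`. [folklore] -/
theorem exists_b_neg_one_of_isUnit [NeZero N] {r : ZMod N} (hr : IsUnit r) :
    ∃ β : Gamma0 N, (β : SL(2, ℤ)) 0 1 = -1 ∧ ((((β : SL(2, ℤ)) 1 1 : ℤ) : ZMod N)) = r := by
  have hcop : Nat.Coprime r.val N := by
    have h := ZMod.val_coe_unit_coprime hr.unit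
    rwa [IsUnit.unit_spec] at h
  obtain ⟨a, b, hab⟩ : IsCoprime (r.val : ℤ) (N : ℤ) := Nat.isCoprime_iff_coprime.mpr hcop
  obtain ⟨β, -, h01, -, h11⟩ := ThetaLayerLambdaCongruenceAtTwo.exists_gamma0_entries (N := N)
    a (-1) (N * b) (r.val : ℤ) (by linear_combination hab) (dvd_mul_right _ _)
  refine ⟨β, h01, ?_⟩
  rw [h11, Int.cast_natCast, ZMod.natCast_zmod_val]

/-- **`F(u) = F(−1/u)`.** For `b = −1` elements `β, β'` with `d(β) d(β') ≡ −1 (mod N)`: `χ β = χ β'` — the companion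
`β♯ = (−d, −1; c, −a) ∈ Γ₀(N)` of `β = (a, −1; c, d)` has `β β♯ = −I` (trace `−2`, killed) and `d(β♯) = −a ≡ −1/d`.
[folklore] -/
theorem chi_eq_of_b_neg_one_of_mul_d_eq_neg_one
    (hadd : ∀ γ δ : Gamma0 N, χ (γ * δ) = χ γ + χ δ)
    (hsmall : ∀ γ : Gamma0 N, ((γ : SL(2, ℤ)) 0 0 + (γ : SL(2, ℤ)) 1 1).natAbs ≤ 2 → χ γ = 0)
    {β β' : Gamma0 N} (hb : (β : SL(2, ℤ)) 0 1 = -1) (hb' : (β' : SL(2, ℤ)) 0 1 = -1)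
    (h : ((((β : SL(2, ℤ)) 1 1 : ℤ) : ZMod N)) * ((((β' : SL(2, ℤ)) 1 1 : ℤ) : ZMod N)) = -1) :
    χ β = χ β' := by
  have h1 := Matrix.SpecialLinearGroup.det_coe (β : SL(2, ℤ))
  rw [Matrix.det_fin_two, hb] at h1
  have hcN : (N : ℤ) ∣ (β : SL(2, ℤ)) 1 0 := by
    have hmem := β.2
    rw [Gamma0_mem] at hmem
    exact (ZMod.intCast_zmod_eq_zero_iff_dvd _ N).mp hmem
  obtain ⟨γ, h00, h01, h10, h11⟩ := ThetaLayerLambdaCongruenceAtTwo.exists_gamma0_entries (N := N)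
    (-(β : SL(2, ℤ)) 1 1) (-1) ((β : SL(2, ℤ)) 1 0) (-(β : SL(2, ℤ)) 0 0) (by linear_combination h1) hcN
  -- `β γ = −I`
  have htr : (((β * γ : Gamma0 N) : SL(2, ℤ)) 0 0 + ((β * γ : Gamma0 N) : SL(2, ℤ)) 1 1).natAbs ≤ 2 := by
    rw [gamma0_mul_apply_zero_zero', gamma0_mul_apply_one_one', h00, h10, h01, h11, hb]
    have e : (β : SL(2, ℤ)) 0 0 * -(β : SL(2, ℤ)) 1 1 + -1 * (β : SL(2, ℤ)) 1 0 +
        ((β : SL(2, ℤ)) 1 0 * -1 + (β : SL(2, ℤ)) 1 1 * -(β : SL(2, ℤ)) 0 0) = -2 := by linear_combination (-2 : ℤ) * h1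
    rw [e]; decide
  have hβγ : χ γ = χ β := by
    have h0 := hsmall _ htr
    rw [hadd] at h0
    have e : χ γ = -χ β := by linear_combination h0
    rw [e, ZMod.neg_eq_self_mod_two]
  -- `d(β') ≡ d(γ) = −a(β)`
  have hda := gamma0_apply_one_one_mul_apply_zero_zero β
  have hd' : ((((β' : SL(2, ℤ)) 1 1 : ℤ) : ZMod N)) = ((((γ : SL(2, ℤ)) 1 1 : ℤ) : ZMod N)) := by
    rw [h11, Int.cast_neg]
    calc ((((β' : SL(2, ℤ)) 1 1 : ℤ) : ZMod N))
        = ((((β' : SL(2, ℤ)) 1 1 : ℤ) : ZMod N)) *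
            (((((β : SL(2, ℤ)) 1 1 : ℤ) : ZMod N)) * ((((β : SL(2, ℤ)) 0 0 : ℤ) : ZMod N))) := by rw [hda, mul_one]
      _ = (((((β : SL(2, ℤ)) 1 1 : ℤ) : ZMod N)) * ((((β' : SL(2, ℤ)) 1 1 : ℤ) : ZMod N))) *
            ((((β : SL(2, ℤ)) 0 0 : ℤ) : ZMod N)) := by ring
      _ = -((((β : SL(2, ℤ)) 0 0 : ℤ) : ZMod N)) := by rw [h, neg_one_mul]
  rw [← hβγ]
  exact (chi_eq_of_apply_zero_one_eq_neg_one hadd hsmall h01 hb' hd'.symm)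

end AnyLevel

/-! ## §2. `F(u) = F(−4/u)` and `F(4u) = F(u)` at prime level (Dirichlet) -/

section PrimeLevel

variable {p : ℕ} [Fact p.Prime] {χ : Gamma0 p → ZMod 2}

/-- **`F(u) = F(−4/u)` at an odd prime level.** For `b = −1` elements `β, β'` of `Γ₀(p)` with `d(β) d(β') ≡ −4 (mod p)`:
`χ β = χ β'`. A prime `q ≡ −1 (mod 4(p−1))`, `q ≡ d(β) (mod p)` (Dirichlet) and `k := ((q−1)/2)²` give `q ∣ 4^k − 1`,
`4^k ≡ 4 (mod p)`, and a product `β₁ β₂` of `b = −1` elements (`d(β₁) = q`, `q d(β₂) ≡ −4^k`) with lower-right entry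
exactly `−4^k`. [cite: Pollack2003, Conj. 6.3] -/
theorem chi_eq_of_b_neg_one_of_mul_d_eq_neg_four (hp2 : p ≠ 2)
    (hadd : ∀ γ δ : Gamma0 p, χ (γ * δ) = χ γ + χ δ)
    (hsmall : ∀ γ : Gamma0 p, ((γ : SL(2, ℤ)) 0 0 + (γ : SL(2, ℤ)) 1 1).natAbs ≤ 2 → χ γ = 0)
    (hkill : ∀ γ : Gamma0 p, (∃ k : ℕ, 1 ≤ k ∧ ((γ : SL(2, ℤ)) 1 1).natAbs = 4 ^ k) → χ γ = 0)
    {β β' : Gamma0 p} (hb : (β : SL(2, ℤ)) 0 1 = -1) (hb' : (β' : SL(2, ℤ)) 0 1 = -1)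
    (h : ((((β : SL(2, ℤ)) 1 1 : ℤ) : ZMod p)) * ((((β' : SL(2, ℤ)) 1 1 : ℤ) : ZMod p)) = -4) :
    χ β = χ β' := by
  have hp : p.Prime := Fact.out
  have hp2' : 2 ≤ p := hp.two_le
  set d : ℤ := (β : SL(2, ℤ)) 1 1 with hd
  have hdu : IsUnit ((d : ℤ) : ZMod p) := isUnit_gamma0_apply_one_one β
  -- the modulus `n = 4(p−1)` and the Dirichlet prime `q ≡ −1 (mod n)`, `q ≡ d (mod p)`
  set n : ℕ := 4 * (p - 1) with hn
  have hn1 : 1 ≤ n := by omega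
  have h2p : Nat.Coprime 2 p := (Nat.coprime_primes Nat.prime_two hp).mpr (Ne.symm hp2)
  have hpn : ¬ p ∣ n := by
    intro hdvd
    rcases (Nat.Prime.dvd_mul hp).mp hdvd with h4 | h4
    · have h22 : p ∣ 2 ^ 2 := by norm_num; exact h4
      exact hp2 ((Nat.prime_dvd_prime_iff_eq hp Nat.prime_two).mp (hp.dvd_of_dvd_pow h22))
    · have : p ≤ p - 1 := Nat.le_of_dvd (by omega) h4
      omega
  have hcop : Nat.Coprime n p := ((Nat.Prime.coprime_iff_not_dvd hp).mpr hpn).symm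
  set b : ℕ := ((d : ℤ) : ZMod p).val with hbdef
  have hb0 : b ≠ 0 := fun h0 ↦ hdu.ne_zero ((ZMod.val_eq_zero _).mp h0)
  have hbp : b < p := ZMod.val_lt _
  have hbcop : Nat.Coprime b p :=
    ((Nat.Prime.coprime_iff_not_dvd hp).mpr fun hdvd ↦ hb0 (Nat.eq_zero_of_dvd_of_lt hdvd hbp)).symm
  obtain ⟨k0, hk0n, hk0p⟩ := Nat.chineseRemainder hcop (n - 1) b
  have hk0cop : Nat.Coprime k0 (n * p) := by
    apply Nat.Coprime.mul_right
    · have h' : Nat.Coprime (n - 1) (n - 1 + 1) := Nat.coprime_self_add_right.mpr (Nat.coprime_one_right _)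
      rw [Nat.sub_add_cancel hn1] at h'
      show Nat.gcd k0 n = 1
      rw [hk0n.gcd_eq]; exact h'
    · show Nat.gcd k0 p = 1
      rw [hk0p.gcd_eq]; exact hbcop
  obtain ⟨q, hq2, hqprime, hqmod⟩ := Nat.forall_exists_prime_gt_and_modEq 2 (q := n * p) (a := k0)
    (Nat.mul_ne_zero (by omega) hp.ne_zero) hk0cop
  have hqn : q ≡ n - 1 [MOD n] := (hqmod.of_mul_right p).trans hk0n
  have hqp : q ≡ b [MOD p] := (hqmod.of_mul_left n).trans hk0p
  -- `q + 1 = n j`, `e := (q − 1)/2 = 2(p−1)j − 1`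
  have hndvd : n ∣ q + 1 := by
    have e : q + 1 ≡ n - 1 + 1 [MOD n] := hqn.add_right 1
    rw [Nat.sub_add_cancel hn1] at e
    exact Nat.modEq_zero_iff_dvd.mp (e.trans (Nat.modEq_zero_iff_dvd.mpr dvd_rfl))
  obtain ⟨j, hj⟩ := hndvd
  have hj1 : 1 ≤ j := by
    rcases Nat.eq_zero_or_pos j with h0 | h0
    · rw [h0, mul_zero] at hj; omega
    · exact h0
  have ht1 : 1 ≤ (p - 1) * j := Nat.one_le_iff_ne_zero.mpr (Nat.mul_ne_zero (by omega) (by omega))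
  have h2t : 2 * (p - 1) * j = 2 * ((p - 1) * j) := by ring
  have hnj : n * j = 4 * ((p - 1) * j) := by rw [hn]; ring
  set e : ℕ := 2 * (p - 1) * j - 1 with he
  have he1 : 1 ≤ e := by omega
  have hqe : q = 2 * e + 1 := by omega
  have hpe : (p - 1) ∣ e + 1 := ⟨2 * j, by rw [show (p - 1) * (2 * j) = 2 * ((p - 1) * j) by ring]; omega⟩
  -- Fermat mod `q`: `4^e = 2^(q−1) ≡ 1`
  haveI : Fact q.Prime := ⟨hqprime⟩
  have h2q : (2 : ZMod q) ≠ 0 := by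
    intro h0
    have h0' : ((2 : ℕ) : ZMod q) = 0 := by exact_mod_cast h0
    have := Nat.le_of_dvd (by norm_num) ((ZMod.natCast_eq_zero_iff 2 q).mp h0')
    omega
  have h4e : (4 : ZMod q) ^ e = 1 := by
    rw [show (4 : ZMod q) = 2 ^ 2 by norm_num, ← pow_mul, show 2 * e = q - 1 by omega,
      ZMod.pow_card_sub_one_eq_one h2q]
  -- `k := e²`: `q ∣ 4^k − 1` and `k ≡ 1 (mod p − 1)`, so `4^k ≡ 4 (mod p)`
  set k : ℕ := e * e with hk
  have hk1 : 1 ≤ k := Nat.one_le_iff_ne_zero.mpr (Nat.mul_ne_zero (by omega) (by omega))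
  have hqdvd : (q : ℤ) ∣ 4 ^ k - 1 := by
    have h1 : (q : ℤ) ∣ 4 ^ e - 1 := by
      rw [← ZMod.intCast_zmod_eq_zero_iff_dvd]; push_cast; rw [h4e, sub_self]
    have h2 : ((4 : ℤ) ^ e - 1) ∣ (4 ^ e) ^ e - 1 ^ e := sub_dvd_pow_sub_pow _ _ _
    rw [one_pow, ← pow_mul] at h2
    exact h1.trans h2
  obtain ⟨m₀, hm₀⟩ := hqdvd
  have hdk : (p - 1) ∣ k - 1 := by
    have e1 : k - 1 = (e + 1) * (e - 1) := by rw [hk, ← Nat.mul_self_sub_mul_self_eq e 1]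
    rw [e1]; exact hpe.mul_right _
  obtain ⟨m, hm⟩ := hdk
  have hkm : k = 1 + (p - 1) * m := by omega
  have h4p : (4 : ZMod p) ≠ 0 := by
    intro h0
    have h0' : ((4 : ℕ) : ZMod p) = 0 := by exact_mod_cast h0
    have h4 : p ∣ 2 ^ 2 := by norm_num; exact (ZMod.natCast_eq_zero_iff 4 p).mp h0'
    exact hp2 ((Nat.prime_dvd_prime_iff_eq hp Nat.prime_two).mp (hp.dvd_of_dvd_pow h4))
  have h4k : (4 : ZMod p) ^ k = 4 := by
    rw [hkm, pow_add, pow_one, pow_mul, ZMod.pow_card_sub_one_eq_one h4p, one_pow, mul_one]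
  -- Bezout for `(q, p)` and the element `β₁ = (α₁, −1; pκ₁, q)`
  have hqp' : ¬ p ∣ q := fun hdvd ↦ by
    have e2 : b ≡ 0 [MOD p] := hqp.symm.trans (Nat.modEq_zero_iff_dvd.mpr hdvd)
    exact hb0 (Nat.eq_zero_of_dvd_of_lt (Nat.modEq_zero_iff_dvd.mp e2) hbp)
  obtain ⟨α₁, κ₁, h1⟩ : IsCoprime (q : ℤ) (p : ℤ) :=
    Nat.isCoprime_iff_coprime.mpr ((Nat.Prime.coprime_iff_not_dvd hp).mpr hqp').symm
  obtain ⟨β₁, -, h101, h110, h111⟩ := ThetaLayerLambdaCongruenceAtTwo.exists_gamma0_entries (N := p)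
    α₁ (-1) (p * κ₁) q (by linear_combination h1) (dvd_mul_right _ _)
  -- `δ₂ := −m₀ − α₁` is prime to `p` since `q δ₂ = −4^k + κ₁ p`; the element `β₂ = (α₂, −1; pκ₂, δ₂)`
  set δ₂ : ℤ := -m₀ - α₁ with hδ₂
  have hqδ : (q : ℤ) * δ₂ = -4 ^ k + κ₁ * p := by
    rw [hδ₂]; linear_combination hm₀ - h1
  have hcop4 : IsCoprime ((4 : ℤ) ^ k) p := by
    apply IsCoprime.pow_left
    rw [show (4 : ℤ) = ((4 : ℕ) : ℤ) by norm_num, Nat.isCoprime_iff_coprime]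
    simpa using h2p.pow_left 2
  have hcopδ : IsCoprime δ₂ (p : ℤ) := by
    have e1 : IsCoprime ((q : ℤ) * δ₂) p := by
      rw [hqδ]; exact (hcop4.neg_left).add_mul_right_left κ₁
    exact e1.of_mul_left_right
  obtain ⟨α₂, κ₂, h2⟩ := hcopδ
  obtain ⟨β₂, -, h201, -, h211⟩ := ThetaLayerLambdaCongruenceAtTwo.exists_gamma0_entries (N := p)
    α₂ (-1) (p * κ₂) δ₂ (by linear_combination h2) (dvd_mul_right _ _)
  -- the product has lower-right entry `−4^k`, so `χ β₁ = χ β₂`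
  have hprod : ((β₁ * β₂ : Gamma0 p) : SL(2, ℤ)) 1 1 = -4 ^ k := by
    rw [gamma0_mul_apply_one_one', h110, h201, h111, h211]; linear_combination hqδ
  have hkilled : χ (β₁ * β₂) = 0 :=
    hkill _ ⟨k, hk1, by rw [hprod, Int.natAbs_neg, Int.natAbs_pow]; rfl⟩
  have h12 : χ β₁ = χ β₂ := by
    rw [hadd] at hkilled
    have e1 : χ β₁ = -χ β₂ := by linear_combination hkilled
    rw [e1, ZMod.neg_eq_self_mod_two]
  -- residues: `d(β₁) ≡ d(β)` and `d(β) d(β₂) ≡ −4 ≡ d(β) d(β')`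
  have hqb : (q : ZMod p) = (b : ZMod p) := (ZMod.natCast_eq_natCast_iff _ _ _).mpr hqp
  have hres1 : ((((β₁ : SL(2, ℤ)) 1 1 : ℤ) : ZMod p)) = ((d : ℤ) : ZMod p) := by
    rw [h111, Int.cast_natCast, hqb, hbdef, ZMod.natCast_zmod_val]
  have hres2 : ((d : ℤ) : ZMod p) * (((δ₂ : ℤ) : ZMod p)) = -4 := by
    rw [← hres1, h111]
    have e1 := congrArg (Int.cast : ℤ → ZMod p) hqδ
    push_cast at e1 ⊢
    rw [e1, h4k, ZMod.natCast_self, mul_zero, add_zero]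
  have hres3 : ((((β' : SL(2, ℤ)) 1 1 : ℤ) : ZMod p)) = ((((β₂ : SL(2, ℤ)) 1 1 : ℤ) : ZMod p)) := by
    rw [h211]
    exact hdu.mul_left_cancel (h.trans hres2.symm)
  rw [chi_eq_of_apply_zero_one_eq_neg_one hadd hsmall hb h101 hres1.symm, h12,
    ← chi_eq_of_apply_zero_one_eq_neg_one hadd hsmall hb' h201 hres3]

/-- **`F(4u) = F(u)` at an odd prime level.** For `b = −1` elements with `d(β) ≡ 4 d(β') (mod p)`: `χ β = χ β'`
(`u ↦ −4/u ↦ −1/(−4/u) = u/4`: Theorem 2 then Theorem 1). [cite: Pollack2003, Conj. 6.3] -/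
theorem chi_eq_of_b_neg_one_of_d_eq_four_mul (hp2 : p ≠ 2)
    (hadd : ∀ γ δ : Gamma0 p, χ (γ * δ) = χ γ + χ δ)
    (hsmall : ∀ γ : Gamma0 p, ((γ : SL(2, ℤ)) 0 0 + (γ : SL(2, ℤ)) 1 1).natAbs ≤ 2 → χ γ = 0)
    (hkill : ∀ γ : Gamma0 p, (∃ k : ℕ, 1 ≤ k ∧ ((γ : SL(2, ℤ)) 1 1).natAbs = 4 ^ k) → χ γ = 0)
    {β β' : Gamma0 p} (hb : (β : SL(2, ℤ)) 0 1 = -1) (hb' : (β' : SL(2, ℤ)) 0 1 = -1)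
    (h : ((((β : SL(2, ℤ)) 1 1 : ℤ) : ZMod p)) = 4 * ((((β' : SL(2, ℤ)) 1 1 : ℤ) : ZMod p))) :
    χ β = χ β' := by
  have hu := isUnit_gamma0_apply_one_one β'
  obtain ⟨β₁, hb1, hd1⟩ := exists_b_neg_one_of_isUnit (N := p) (hu.unit⁻¹).isUnit.neg
  have e1 : ((((β : SL(2, ℤ)) 1 1 : ℤ) : ZMod p)) * ((((β₁ : SL(2, ℤ)) 1 1 : ℤ) : ZMod p)) = -4 := by
    rw [h, hd1, mul_neg, mul_assoc, IsUnit.mul_val_inv, mul_one]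
  have e2 : ((((β₁ : SL(2, ℤ)) 1 1 : ℤ) : ZMod p)) * ((((β' : SL(2, ℤ)) 1 1 : ℤ) : ZMod p)) = -1 := by
    rw [hd1, neg_mul, IsUnit.val_inv_mul]
  rw [chi_eq_of_b_neg_one_of_mul_d_eq_neg_four hp2 hadd hsmall hkill hb hb1 e1,
    chi_eq_of_b_neg_one_of_mul_d_eq_neg_one hadd hsmall hb1 hb' e2]

end PrimeLevel

end Summit.BirchSwinnertonDyer.BirchSwinnertonDyer.Theorems.SignedMuAtTwo
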